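import Summits.QuantumFields.YangMills.Theorems.BalabanLadderNTMirrorHankelTorus
import HarnessLib

/-!
# Crux `NT` (stmt-QuantumFields-19353): a β-uniform mirror floor on all large tori caps the mass — `μ·u ≤ log(K²/X)`

Helper file (`--supports stmt-QuantumFields-19353`) of the fleet lead prover of crux `NT` (unit `ym-spine-19353-p1`,
g10), hypothesis-free; corollary of the mirror-Hankel series (`…NTMirrorHankelShift` / `…Hankel` / `…Convex` /
`…Torus`).  The finite-torus cap `mul_mul_le_log_of_mirrorFloor_of_clustering` reads
`μ·u·U ≤ U·log(K²/X) + u·log(C/K²)` at one far lag `U` of ONE torus.  Clause (i) / the seam's (MF) floor is demanded on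
EVERY large torus, and the IR leg's clustering (`GapInUnits`) is a bound `≤ C·e^{−μ n}` at every lag `n ≤ L` of every
large torus `2L+1`; feeding the far lag `U = L` and letting `L → ∞` removes the prefactor:

* `mul_le_of_forall_mul_mul_le` — the Archimedean step: `(∀ U ≥ U₀, μ·u·U ≤ U·A + u·B) ⇒ μ·u ≤ A`;
* **`mul_le_log_of_mirrorFloor_of_gapShape`** — for every compact `G`, lattice representation `r`, `β ≥ 0`, bounded
  measurable window cylinder `W` (links based at times in `[0, T−1]`, `|W| ≤ K`, `0 < K`): if
  `X ≤ Cov_{2L+1}(W∘Θ₀, τ_{u e₀}W)` for all `L ≥ L₀` (`X > 0`) and `Cov_{2L+1}(W∘Θ₀, τ_{n e₀}W) ≤ C·e^{−μ n}` for all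
  `L ≥ L₀`, `n ≤ L` (`C > 0`), then **`μ · u ≤ log (K²/X)`**;
* `exp_mul_le_of_mirrorFloor_of_gapShape` — the same as `X · e^{μ u} ≤ K²`: the floor size times the clustering factor over
  the floor's own lag never exceeds the trivial ceiling.

Reading for the crux (nothing registered): with `W = Ṽ_v` moved to the mirror (`u = 2δ/a(β)`, `K ≤ 6N Σ_y |v(a(β)y)| ≍ ‖v‖₁a⁻⁴`)
and the IR leg's rate `μ = c₁·a(β)` (physical mass `c₁`): `2δ·c₁ ≤ log(36N²(Σ|v|)²/X) ≈ 8 log(1/a(β)) + O(1)` — the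
clause-(i) floor and a physical mass `c₁` coexist along `a(β) → 0` only if `c₁ = O(log(1/a(β))) = O(β)`; equivalently a
lattice correlation length `ξ_lat(β) = 1/μ` shorter than `2δ/(a(β)·(8 log(1/a(β)) + O(1)))` kills every floor of size `X`
at physical offset `δ` («in finer units the floors die by clustering», with the rate).

Refs: J. Glimm, A. Jaffe, *Quantum Physics* (1987) §6.1; E. Seiler, LNP 159 (1982) Ch. 2 (mass gap = decay rate of the
reflection-positive two-point function; here only the finite-torus inequalities are used).
-/

set_option autoImplicit false

noncomputable section

open MeasureTheory Finset
open Literature.MathematicalPhysics.QuantumFieldTheory Literature.MathematicalPhysics.QuantumLattice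
open Literature.Probability.LatticeModels

namespace Summit.QuantumFields.YangMills.Cruxes.NT.MirrorHankel

/-! ## §1 The Archimedean step -/

/-- If `μ·u·U ≤ U·A + u·B` for all natural `U ≥ U₀`, then `μ·u ≤ A`. [folklore] -/
theorem mul_le_of_forall_mul_mul_le {μ A B : ℝ} {u U₀ : ℕ}
    (h : ∀ U : ℕ, U₀ ≤ U → μ * u * U ≤ U * A + u * B) : μ * u ≤ A := by
  by_contra hcon
  rw [not_le] at hcon
  -- `ε := μ u − A > 0`; choose `U > max U₀ (u B / ε)`
  set ε := μ * u - A with hε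
  have hεpos : 0 < ε := by linarith
  obtain ⟨N, hN⟩ := exists_nat_gt ((u : ℝ) * B / ε)
  have hU := h (max U₀ N + 1) (by omega)
  have hUge : ((u : ℝ) * B / ε) < ((max U₀ N + 1 : ℕ) : ℝ) := by
    have : (N : ℝ) ≤ ((max U₀ N + 1 : ℕ) : ℝ) := by exact_mod_cast (by omega : N ≤ max U₀ N + 1)
    linarith
  have hpos : (0 : ℝ) < ((max U₀ N + 1 : ℕ) : ℝ) := by positivity
  -- `ε · U ≤ u B` contradicts `U > u B / ε`
  have h1 : ε * ((max U₀ N + 1 : ℕ) : ℝ) ≤ (u : ℝ) * B := by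
    have := hU
    rw [hε]
    nlinarith
  have h2 : (u : ℝ) * B < ((max U₀ N + 1 : ℕ) : ℝ) * ε := by
    rwa [div_lt_iff₀ hεpos] at hUge
  linarith

/-! ## §2 The cap along a sequence of tori -/

section RouteLetters

variable {G : Type} [Group G] [TopologicalSpace G] [IsTopologicalGroup G] [CompactSpace G]
  [MeasurableSpace G] [BorelSpace G] {r : LatticeRep G}
variable {W : LGConfig 4 G → ℝ} {SW : Finset (Literature.MathematicalPhysics.QuantumLattice.ZdEdge 4)} {T : ℕ}

/-- **A β-uniform mirror floor on all large tori caps the clustering rate: `μ·u ≤ log(K²/X)`.**  For a bounded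
measurable window cylinder `W` (links based at times in `[0, T−1]`, `|W| ≤ K`, `0 < K`), `β ≥ 0`: if the mirror
correlator has the floor `X ≤ Cov_{2L+1}(W∘Θ₀, τ_{u e₀}W)` (`0 < X`) on every torus `L ≥ L₀`, and clusters,
`Cov_{2L+1}(W∘Θ₀, τ_{n e₀}W) ≤ C·e^{−μ n}` for all `n ≤ L` on every torus `L ≥ L₀` (`0 < C`; the shape of `GapInUnits`),
then `μ · u ≤ log (K²/X)`. [cite: GlimmJaffe1987, §6.1] -/
theorem mul_le_log_of_mirrorFloor_of_gapShape {β : ℝ} (hβ : 0 ≤ β) (hWm : Measurable W) {K : ℝ} (hKpos : 0 < K)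
    (hK : ∀ V, |W V| ≤ K) (hWS : IsCylinder W SW) (hw : ∀ e ∈ SW, 0 ≤ e.1 0 ∧ e.1 0 + 1 ≤ T) {u L₀ : ℕ}
    {X C μ : ℝ} (hX : 0 < X) (hC : 0 < C)
    (hfloor : ∀ L : ℕ, L₀ ≤ L →
      X ≤ latticeConnectedCorr r.ρ β (2 * L + 1) (fun V => W (cfgReflect V)) W u)
    (hgap : ∀ L : ℕ, L₀ ≤ L → ∀ n : ℕ, n ≤ L →
      latticeConnectedCorr r.ρ β (2 * L + 1) (fun V => W (cfgReflect V)) W n ≤ C * Real.exp (-(μ * n))) :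
    μ * u ≤ Real.log (K ^ 2 / X) := by
  refine mul_le_of_forall_mul_mul_le (U₀ := max (max L₀ (2 * T)) (u + 1)) (B := Real.log (C / K ^ 2)) fun L hL => ?_
  have hL₀ : L₀ ≤ L := le_trans (le_max_left _ _ |>.trans (le_max_left _ _)) hL
  have hL1 : 1 ≤ L := by omega
  exact mul_mul_le_log_of_mirrorFloor_of_clustering (r := r) hβ hL1 hWm hKpos hK hWS hw (u := u) (U := L)
    (by omega) (by omega) hX (hfloor L hL₀) hC (hgap L hL₀ L le_rfl)

/-- The same cap, exponentiated: **`X · e^{μ u} ≤ K²`** — the floor size times the clustering factor over the floor's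
own lag never exceeds the trivial ceiling `K²`. [cite: GlimmJaffe1987, §6.1] -/
theorem exp_mul_le_of_mirrorFloor_of_gapShape {β : ℝ} (hβ : 0 ≤ β) (hWm : Measurable W) {K : ℝ} (hKpos : 0 < K)
    (hK : ∀ V, |W V| ≤ K) (hWS : IsCylinder W SW) (hw : ∀ e ∈ SW, 0 ≤ e.1 0 ∧ e.1 0 + 1 ≤ T) {u L₀ : ℕ}
    {X C μ : ℝ} (hX : 0 < X) (hC : 0 < C)
    (hfloor : ∀ L : ℕ, L₀ ≤ L →
      X ≤ latticeConnectedCorr r.ρ β (2 * L + 1) (fun V => W (cfgReflect V)) W u)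
    (hgap : ∀ L : ℕ, L₀ ≤ L → ∀ n : ℕ, n ≤ L →
      latticeConnectedCorr r.ρ β (2 * L + 1) (fun V => W (cfgReflect V)) W n ≤ C * Real.exp (-(μ * n))) :
    X * Real.exp (μ * u) ≤ K ^ 2 := by
  have h := mul_le_log_of_mirrorFloor_of_gapShape hβ hWm hKpos hK hWS hw hX hC hfloor hgap
  have hK2 : 0 < K ^ 2 := pow_pos hKpos 2
  have h' : Real.exp (μ * u) ≤ K ^ 2 / X := by
    calc Real.exp (μ * u) ≤ Real.exp (Real.log (K ^ 2 / X)) := Real.exp_le_exp.mpr h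
      _ = K ^ 2 / X := Real.exp_log (div_pos hK2 hX)
  rw [le_div_iff₀ hX] at h'
  linarith [h']

end RouteLetters

end Summit.QuantumFields.YangMills.Cruxes.NT.MirrorHankel

end
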